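import Literature.NumberTheory.Automorphic.ArchTorusCoordinatesGL2
import Literature.Analysis.FunctionSpaces.SeparationOfVariables
import HarnessLib

/-!
# Factorisation of a Kirillov function of `GL₂(K_∞)` over the archimedean places
# (Jacquet–Langlands (1970), §5–§6, §11 proof of Thm. 11.1)

Topic `NumberTheory/Automorphic`; namespace `Literature.NumberTheory.Automorphic`. Definitions with bodies
(`CoordType`, `coordUnits`, the per-place predicates `RealShapeAt`, `ComplexShapeAt`) and theorems; no
named fact, no instance.

Let `W_e(u) = ℓ(τ(diag(u,1)) e)` (`kirillovFn`) be the Kirillov function of a Gårding vector `e` of a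
representation `τ` of `GL₂(K_∞)`. Suppose that at every real place `w` the dependence on the coordinate `u_w`
is RIGID: for every `u'` with `u'_w = 1` there is a constant `c` with `W_e(u' · ι_w(t)) = c F_w(t)` for all
`t ∈ ℝˣ` (`RealShapeAt`), and similarly at the complex places (`ComplexShapeAt`). Then
(`exists_kirillovFn_eq_const_mul_prod`)

  `W_e(u) = C ∏_{w real} F_w(u_w) ∏_{w complex} G_w(u_w)`

for a constant `C` (separation of variables, `Literature.Analysis.FunctionSpaces.exists_eq_const_mul_prod`,
in the coordinates `K_∞ˣ = ∏ ℝˣ × ∏ ℂˣ`). This is the form in which the archimedean zeta integral of a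
`K_∞`-finite vector factors into local Tate/Jacquet–Langlands integrals.

## References

* H. Jacquet, R. P. Langlands, *Automorphic Forms on GL(2)*, LNM 114 (1970), §5 Thm. 5.15, §6 Thm. 6.4,
  proof of Thm. 11.1 (p. 173). [JacquetLanglands1970]
-/

noncomputable section

open NumberField NumberField.InfinitePlace NumberField.mixedEmbedding Set
open scoped MatrixGroups Classical

namespace Literature.NumberTheory.Automorphic

variable (K : Type) [Field K] [NumberField K]

/-! ### 1. Coordinates `K_∞ˣ = ∏_{w real} ℝˣ × ∏_{w complex} ℂˣ` -/

section Coordinates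

/-- The coordinate type at an archimedean place: `ℝˣ` at a real place, `ℂˣ` at a complex one. [folklore] -/
abbrev CoordType : {w : InfinitePlace K // IsReal w} ⊕ {w : InfinitePlace K // IsComplex w} → Type
  | Sum.inl _ => ℝˣ
  | Sum.inr _ => ℂˣ

/-- Each coordinate type is non-empty. [folklore] -/
instance nonempty_coordType (i : {w : InfinitePlace K // IsReal w} ⊕ {w : InfinitePlace K // IsComplex w}) :
    Nonempty (CoordType K i) := by
  rcases i with w | w
  · exact ⟨(1 : ℝˣ)⟩
  · exact ⟨(1 : ℂˣ)⟩

/-- The unit of `K_∞` with the given coordinates. [folklore] -/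
def coordUnits (t : ∀ i, CoordType K i) : (mixedSpace K)ˣ :=
  (∏ w, realUnitAt K w (t (Sum.inl w))) * ∏ w, complexUnitAt K w (t (Sum.inr w))

/-- The value of `coordUnits t` in `K_∞`. [folklore] -/
theorem coe_coordUnits (t : ∀ i, CoordType K i) :
    ((coordUnits K t : (mixedSpace K)ˣ) : mixedSpace K) =
      ((fun w => ((t (Sum.inl w) : ℝˣ) : ℝ)), fun w => ((t (Sum.inr w) : ℂˣ) : ℂ)) := by
  rw [coordUnits, Units.val_mul, Units.coe_prod, Units.coe_prod]
  simp only [Units.coe_map, MonoidHom.coe_comp, Function.comp_apply]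
  simp only [MonoidHom.mulSingle_apply, MonoidHom.inl_apply, MonoidHom.inr_apply]
  refine Prod.ext ?_ ?_
  · rw [Prod.fst_mul, Prod.fst_prod, Prod.fst_prod, Finset.prod_const_one, mul_one, Finset.univ_prod_mulSingle]
  · rw [Prod.snd_mul, Prod.snd_prod, Prod.snd_prod, Finset.prod_const_one, one_mul, Finset.univ_prod_mulSingle]

/-- Every unit of `K_∞` has coordinates. [folklore] -/
theorem coordUnits_unitsAt (u : (mixedSpace K)ˣ) :
    coordUnits K (fun i => match i with | Sum.inl w => unitsFstAt u w | Sum.inr w => unitsSndAt u w) = u := by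
  rw [coordUnits]
  exact (units_eq_prod_coordUnits u).symm

/-- `coordUnits t = coordUnits (t with t_w := 1) · ι_w(t_w)` at a real place. [folklore] -/
theorem coordUnits_eq_update_mul_realUnitAt (t : ∀ i, CoordType K i) (w : {w : InfinitePlace K // IsReal w}) :
    coordUnits K t = coordUnits K (Function.update t (Sum.inl w) (1 : ℝˣ)) * realUnitAt K w (t (Sum.inl w)) := by
  refine Units.ext ?_
  rw [Units.val_mul, coe_coordUnits, coe_coordUnits, coe_realUnitAt]
  refine Prod.ext (funext fun v => ?_) (funext fun v => ?_)
  · change ((t (Sum.inl v) : ℝˣ) : ℝ) = ((Function.update t (Sum.inl w) (1 : ℝˣ) (Sum.inl v) : ℝˣ) : ℝ) *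
      Pi.mulSingle (M := fun _ : {w : InfinitePlace K // IsReal w} => ℝ) w ((t (Sum.inl w) : ℝˣ) : ℝ) v
    by_cases hv : v = w
    · subst hv
      rw [Function.update_self, Pi.mulSingle_eq_same, Units.val_one, one_mul]
    · rw [Function.update_of_ne (fun h => hv (Sum.inl_injective h)), Pi.mulSingle_eq_of_ne hv, mul_one]
  · change ((t (Sum.inr v) : ℂˣ) : ℂ) = ((Function.update t (Sum.inl w) (1 : ℝˣ) (Sum.inr v) : ℂˣ) : ℂ) * 1
    rw [Function.update_of_ne Sum.inr_ne_inl, mul_one]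

/-- `coordUnits t = coordUnits (t with t_w := 1) · ι_w(t_w)` at a complex place. [folklore] -/
theorem coordUnits_eq_update_mul_complexUnitAt (t : ∀ i, CoordType K i) (w : {w : InfinitePlace K // IsComplex w}) :
    coordUnits K t = coordUnits K (Function.update t (Sum.inr w) (1 : ℂˣ)) * complexUnitAt K w (t (Sum.inr w)) := by
  refine Units.ext ?_
  rw [Units.val_mul, coe_coordUnits, coe_coordUnits, coe_complexUnitAt]
  refine Prod.ext (funext fun v => ?_) (funext fun v => ?_)
  · change ((t (Sum.inl v) : ℝˣ) : ℝ) = ((Function.update t (Sum.inr w) (1 : ℂˣ) (Sum.inl v) : ℝˣ) : ℝ) * 1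
    rw [Function.update_of_ne Sum.inl_ne_inr, mul_one]
  · change ((t (Sum.inr v) : ℂˣ) : ℂ) = ((Function.update t (Sum.inr w) (1 : ℂˣ) (Sum.inr v) : ℂˣ) : ℂ) *
      Pi.mulSingle (M := fun _ : {w : InfinitePlace K // IsComplex w} => ℂ) w ((t (Sum.inr w) : ℂˣ) : ℂ) v
    by_cases hv : v = w
    · subst hv
      rw [Function.update_self, Pi.mulSingle_eq_same, Units.val_one, one_mul]
    · rw [Function.update_of_ne (fun h => hv (Sum.inr_injective h)), Pi.mulSingle_eq_of_ne hv, mul_one]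

/-- The `w`-coordinate of `coordUnits (t with t_w := 1)` is `1` (real place). [folklore] -/
theorem fst_coordUnits_update (t : ∀ i, CoordType K i) (w : {w : InfinitePlace K // IsReal w}) :
    ((coordUnits K (Function.update t (Sum.inl w) (1 : ℝˣ)) : (mixedSpace K)ˣ) : mixedSpace K).1 w = 1 := by
  rw [coe_coordUnits]
  change ((Function.update t (Sum.inl w) (1 : ℝˣ) (Sum.inl w) : ℝˣ) : ℝ) = 1
  rw [Function.update_self, Units.val_one]

/-- The `w`-coordinate of `coordUnits (t with t_w := 1)` is `1` (complex place). [folklore] -/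
theorem snd_coordUnits_update (t : ∀ i, CoordType K i) (w : {w : InfinitePlace K // IsComplex w}) :
    ((coordUnits K (Function.update t (Sum.inr w) (1 : ℂˣ)) : (mixedSpace K)ˣ) : mixedSpace K).2 w = 1 := by
  rw [coe_coordUnits]
  change ((Function.update t (Sum.inr w) (1 : ℂˣ) (Sum.inr w) : ℂˣ) : ℂ) = 1
  rw [Function.update_self, Units.val_one]

end Coordinates

/-! ### 2. Rigid dependence on one coordinate, and the factorisation -/

section Factorisation

variable {K}

/-- **Rigid shape at a real place** of a function `Ψ` on `K_∞ˣ`: for every `u'` with `u'_w = 1` the function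
`t ↦ Ψ(u' ι_w(t))` on `ℝˣ` is a constant multiple of `F`. [cite: JacquetLanglands1970, §5 Thm. 5.15] -/
def RigidRealAt (Ψ : (mixedSpace K)ˣ → ℂ) (w : {w : InfinitePlace K // IsReal w}) (F : ℝ → ℂ) : Prop :=
  ∀ u' : (mixedSpace K)ˣ, ((u' : mixedSpace K).1 w = 1) → ∃ c : ℂ, ∀ t : ℝˣ, Ψ (u' * realUnitAt K w t) = c * F (t : ℝ)

/-- **Rigid shape at a complex place.** [cite: JacquetLanglands1970, §6 Thm. 6.4] -/
def RigidComplexAt (Ψ : (mixedSpace K)ˣ → ℂ) (w : {w : InfinitePlace K // IsComplex w}) (G : ℂ → ℂ) : Prop :=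
  ∀ u' : (mixedSpace K)ˣ, ((u' : mixedSpace K).2 w = 1) → ∃ c : ℂ, ∀ z : ℂˣ, Ψ (u' * complexUnitAt K w z) = c * G (z : ℂ)

omit [NumberField K] in
/-- Unfolding of `RigidRealAt`. [folklore] -/
theorem RigidRealAt.exists_const {Ψ : (mixedSpace K)ˣ → ℂ} {w : {w : InfinitePlace K // IsReal w}} {F : ℝ → ℂ}
    (h : RigidRealAt Ψ w F) {u' : (mixedSpace K)ˣ} (hu' : (u' : mixedSpace K).1 w = 1) :
    ∃ c : ℂ, ∀ t : ℝˣ, Ψ (u' * realUnitAt K w t) = c * F (t : ℝ) := h u' hu'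

omit [NumberField K] in
/-- Unfolding of `RigidComplexAt`. [folklore] -/
theorem RigidComplexAt.exists_const {Ψ : (mixedSpace K)ˣ → ℂ} {w : {w : InfinitePlace K // IsComplex w}} {G : ℂ → ℂ}
    (h : RigidComplexAt Ψ w G) {u' : (mixedSpace K)ˣ} (hu' : (u' : mixedSpace K).2 w = 1) :
    ∃ c : ℂ, ∀ z : ℂˣ, Ψ (u' * complexUnitAt K w z) = c * G (z : ℂ) := h u' hu'

/-- **Factorisation over the places.** If `Ψ` has a rigid shape `F_w` at every real place and `G_w` at every
complex place, then `Ψ(u) = C ∏_w F_w(u_w) ∏_w G_w(u_w)` for a constant `C` (separation of variables).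
[cite: JacquetLanglands1970, proof of Thm. 11.1 (p. 173)] -/
theorem exists_eq_const_mul_prod_of_rigid {Ψ : (mixedSpace K)ˣ → ℂ}
    {F : {w : InfinitePlace K // IsReal w} → ℝ → ℂ} {G : {w : InfinitePlace K // IsComplex w} → ℂ → ℂ}
    (hF : ∀ w, RigidRealAt Ψ w (F w)) (hG : ∀ w, RigidComplexAt Ψ w (G w)) :
    ∃ C : ℂ, ∀ u : (mixedSpace K)ˣ,
      Ψ u = C * ((∏ w, F w ((u : mixedSpace K).1 w)) * ∏ w, G w ((u : mixedSpace K).2 w)) := by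
  -- the function in coordinates and the factors
  set Φ : (∀ i, CoordType K i) → ℂ := fun t => Ψ (coordUnits K t) with hΦ
  set Fi : ∀ i, CoordType K i → ℂ := fun i =>
    Sum.rec (motive := fun i => CoordType K i → ℂ) (fun w x => F w ((x : ℝˣ) : ℝ)) (fun w z => G w ((z : ℂˣ) : ℂ)) i with hFi
  -- the constants, chosen as functions of the "other coordinates"
  have hcR : ∀ (w : {w : InfinitePlace K // IsReal w}) (u₁ u₂ : (mixedSpace K)ˣ) (h₁ : (u₁ : mixedSpace K).1 w = 1)
      (h₂ : (u₂ : mixedSpace K).1 w = 1), u₁ = u₂ →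
      Classical.choose ((hF w).exists_const h₁) = Classical.choose ((hF w).exists_const h₂) := by
    rintro w u₁ u₂ h₁ h₂ rfl; rfl
  have hcC : ∀ (w : {w : InfinitePlace K // IsComplex w}) (u₁ u₂ : (mixedSpace K)ˣ) (h₁ : (u₁ : mixedSpace K).2 w = 1)
      (h₂ : (u₂ : mixedSpace K).2 w = 1), u₁ = u₂ →
      Classical.choose ((hG w).exists_const h₁) = Classical.choose ((hG w).exists_const h₂) := by
    rintro w u₁ u₂ h₁ h₂ rfl; rfl
  have key : ∀ i, ∃ c : (∀ i, CoordType K i) → ℂ,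
      (∀ (t : ∀ i, CoordType K i) (y : CoordType K i), c (Function.update t i y) = c t) ∧ ∀ t, Φ t = c t * Fi i (t i) := by
    rintro (w | w)
    · refine ⟨fun t => Classical.choose ((hF w).exists_const (fst_coordUnits_update K t w)), fun t y => ?_, fun t => ?_⟩
      · exact hcR w _ _ (fst_coordUnits_update K _ w) (fst_coordUnits_update K t w) (by rw [Function.update_idem])
      · have hc := Classical.choose_spec ((hF w).exists_const (fst_coordUnits_update K t w)) (t (Sum.inl w))
        rw [← coordUnits_eq_update_mul_realUnitAt] at hc
        simpa only [hΦ, hFi] using hc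
    · refine ⟨fun t => Classical.choose ((hG w).exists_const (snd_coordUnits_update K t w)), fun t y => ?_, fun t => ?_⟩
      · exact hcC w _ _ (snd_coordUnits_update K _ w) (snd_coordUnits_update K t w) (by rw [Function.update_idem])
      · have hc := Classical.choose_spec ((hG w).exists_const (snd_coordUnits_update K t w)) (t (Sum.inr w))
        rw [← coordUnits_eq_update_mul_complexUnitAt] at hc
        simpa only [hΦ, hFi] using hc
  obtain ⟨C, hC⟩ := Literature.Analysis.FunctionSpaces.exists_eq_const_mul_prod Φ Fi key
  refine ⟨C, fun u => ?_⟩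
  have h := hC (fun i => match i with | Sum.inl w => unitsFstAt u w | Sum.inr w => unitsSndAt u w)
  simp only [hΦ, coordUnits_unitsAt] at h
  rw [h, Fintype.prod_sum_type]
  simp only [hFi]
  rfl

omit [NumberField K] in
/-- Rigid shapes pass to scalar multiples of the function. [folklore] -/
theorem RigidRealAt.const_mul {Ψ : (mixedSpace K)ˣ → ℂ} {w : {w : InfinitePlace K // IsReal w}} {F : ℝ → ℂ}
    (h : RigidRealAt Ψ w F) (a : ℂ) : RigidRealAt (fun u => a * Ψ u) w F := by
  intro u' hu'
  obtain ⟨c, hc⟩ := h u' hu'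
  exact ⟨a * c, fun t => by simp only [hc t, mul_assoc]⟩

omit [NumberField K] in
/-- Rigid shapes pass to scalar multiples of the function (complex place). [folklore] -/
theorem RigidComplexAt.const_mul {Ψ : (mixedSpace K)ˣ → ℂ} {w : {w : InfinitePlace K // IsComplex w}} {G : ℂ → ℂ}
    (h : RigidComplexAt Ψ w G) (a : ℂ) : RigidComplexAt (fun u => a * Ψ u) w G := by
  intro u' hu'
  obtain ⟨c, hc⟩ := h u' hu'
  exact ⟨a * c, fun z => by simp only [hc z, mul_assoc]⟩

/-- **Twisting by a product character.** If `Ψ` is rigid at `w` with shape `F` and `χ(u) = ∏_v χ_v(u_v) ∏_v χ'_v(u_v)`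
is a function of product form, then `χ Ψ` is rigid at `w` with shape `χ_w F`. [folklore] -/
theorem RigidRealAt.mul_prod {Ψ : (mixedSpace K)ˣ → ℂ} {w : {w : InfinitePlace K // IsReal w}} {F : ℝ → ℂ}
    (h : RigidRealAt Ψ w F) (χ : {w : InfinitePlace K // IsReal w} → ℝ → ℂ) (χ' : {w : InfinitePlace K // IsComplex w} → ℂ → ℂ) :
    RigidRealAt (fun u => ((∏ v, χ v ((u : mixedSpace K).1 v)) * ∏ v, χ' v ((u : mixedSpace K).2 v)) * Ψ u) w
      (fun t => χ w t * F t) := by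
  intro u' hu'
  obtain ⟨c, hc⟩ := h u' hu'
  refine ⟨((∏ v ∈ Finset.univ.erase w, χ v ((u' : mixedSpace K).1 v)) * ∏ v, χ' v ((u' : mixedSpace K).2 v)) * c, fun t => ?_⟩
  simp only []
  rw [hc t]
  have e1 : ∀ v, (((u' * realUnitAt K w t : (mixedSpace K)ˣ)) : mixedSpace K).1 v =
      (u' : mixedSpace K).1 v * Pi.mulSingle (M := fun _ : {w : InfinitePlace K // IsReal w} => ℝ) w (t : ℝ) v := fun v => by
    rw [Units.val_mul, coe_realUnitAt, Prod.fst_mul, Pi.mul_apply]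
  have h0 : ∏ v, χ v ((((u' * realUnitAt K w t : (mixedSpace K)ˣ)) : mixedSpace K).1 v) =
      χ w t * ∏ v ∈ Finset.univ.erase w, χ v ((u' : mixedSpace K).1 v) := by
    rw [← Finset.mul_prod_erase Finset.univ _ (Finset.mem_univ w)]
    simp_rw [e1]
    rw [hu', Pi.mulSingle_eq_same, one_mul]
    congr 1
    refine Finset.prod_congr rfl fun v hv => ?_
    rw [Pi.mulSingle_eq_of_ne (Finset.ne_of_mem_erase hv), mul_one]
  have h0' : ∏ v, χ' v ((((u' * realUnitAt K w t : (mixedSpace K)ˣ)) : mixedSpace K).2 v) = ∏ v, χ' v ((u' : mixedSpace K).2 v) := by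
    refine Finset.prod_congr rfl fun v _ => ?_
    rw [Units.val_mul, coe_realUnitAt, Prod.snd_mul, mul_one]
  rw [h0, h0']
  ring

/-- Twisting by a product character (complex place). [folklore] -/
theorem RigidComplexAt.mul_prod {Ψ : (mixedSpace K)ˣ → ℂ} {w : {w : InfinitePlace K // IsComplex w}} {G : ℂ → ℂ}
    (h : RigidComplexAt Ψ w G) (χ : {w : InfinitePlace K // IsReal w} → ℝ → ℂ) (χ' : {w : InfinitePlace K // IsComplex w} → ℂ → ℂ) :
    RigidComplexAt (fun u => ((∏ v, χ v ((u : mixedSpace K).1 v)) * ∏ v, χ' v ((u : mixedSpace K).2 v)) * Ψ u) w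
      (fun z => χ' w z * G z) := by
  intro u' hu'
  obtain ⟨c, hc⟩ := h u' hu'
  refine ⟨((∏ v, χ v ((u' : mixedSpace K).1 v)) * ∏ v ∈ Finset.univ.erase w, χ' v ((u' : mixedSpace K).2 v)) * c, fun z => ?_⟩
  simp only []
  rw [hc z]
  have e1 : ∀ v, (((u' * complexUnitAt K w z : (mixedSpace K)ˣ)) : mixedSpace K).2 v =
      (u' : mixedSpace K).2 v * Pi.mulSingle (M := fun _ : {w : InfinitePlace K // IsComplex w} => ℂ) w (z : ℂ) v := fun v => by
    rw [Units.val_mul, coe_complexUnitAt, Prod.snd_mul, Pi.mul_apply]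
  have h0 : ∏ v, χ' v ((((u' * complexUnitAt K w z : (mixedSpace K)ˣ)) : mixedSpace K).2 v) =
      χ' w z * ∏ v ∈ Finset.univ.erase w, χ' v ((u' : mixedSpace K).2 v) := by
    rw [← Finset.mul_prod_erase Finset.univ _ (Finset.mem_univ w)]
    simp_rw [e1]
    rw [hu', Pi.mulSingle_eq_same, one_mul]
    congr 1
    refine Finset.prod_congr rfl fun v hv => ?_
    rw [Pi.mulSingle_eq_of_ne (Finset.ne_of_mem_erase hv), mul_one]
  have h0' : ∏ v, χ v ((((u' * complexUnitAt K w z : (mixedSpace K)ˣ)) : mixedSpace K).1 v) = ∏ v, χ v ((u' : mixedSpace K).1 v) := by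
    refine Finset.prod_congr rfl fun v _ => ?_
    rw [Units.val_mul, coe_complexUnitAt, Prod.fst_mul, mul_one]
  rw [h0, h0']
  ring

end Factorisation

/-! ### 3. The Kirillov function -/

section Kirillov

variable {K}
variable {hcpt : isCompact_glFiniteIntegralLevel 2 K}
  {E : Type*} [NormedAddCommGroup E] [NormedSpace ℂ E] [CompleteSpace E]
  {τ : ContRepresentation ℂ (AutomorphyDatum.gl 2 K hcpt).arch.carrier E}
  (hτ : τ.IsStronglyContinuous) (ℓ : archGardingSpace hcpt τ →ₗ[ℂ] ℂ)

/-- **Rigidity at a real place for a Kirillov function** from a radial formula for translated vectors: if for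
every `u'` with `u'_w = 1` there is `c` with `ℓ(τ(diag(ι_w(t),1)) τ(diag(u',1)) e) = c F(t)` for all `t ∈ ℝˣ`, then
`W_e` is rigid at `w` with shape `F`. [folklore] -/
theorem rigidRealAt_kirillovFn {e : archGardingSpace hcpt τ} {w : {w : InfinitePlace K // IsReal w}} {F : ℝ → ℂ}
    (h : ∀ u' : (mixedSpace K)ˣ, (u' : mixedSpace K).1 w = 1 →
      ∃ c : ℂ, ∀ t : ℝˣ, ℓ (gardingAct hτ (diagGL2 (realUnitAt K w t) 1) (gardingAct hτ (diagGL2 u' 1) e)) = c * F (t : ℝ)) :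
    RigidRealAt (kirillovFn hτ ℓ e) w F := by
  intro u' hu'
  obtain ⟨c, hc⟩ := h u' hu'
  refine ⟨c, fun t => ?_⟩
  rw [← hc t, kirillovFn_eq_apply_gardingAct, mul_comm u', diagGL2_one_mul, gardingAct_mul, Module.End.mul_apply]

/-- The same at a complex place. [folklore] -/
theorem rigidComplexAt_kirillovFn {e : archGardingSpace hcpt τ} {w : {w : InfinitePlace K // IsComplex w}} {G : ℂ → ℂ}
    (h : ∀ u' : (mixedSpace K)ˣ, (u' : mixedSpace K).2 w = 1 →
      ∃ c : ℂ, ∀ z : ℂˣ, ℓ (gardingAct hτ (diagGL2 (complexUnitAt K w z) 1) (gardingAct hτ (diagGL2 u' 1) e)) = c * G (z : ℂ)) :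
    RigidComplexAt (kirillovFn hτ ℓ e) w G := by
  intro u' hu'
  obtain ⟨c, hc⟩ := h u' hu'
  refine ⟨c, fun z => ?_⟩
  rw [← hc z, kirillovFn_eq_apply_gardingAct, mul_comm u', diagGL2_one_mul, gardingAct_mul, Module.End.mul_apply]

end Kirillov

end Literature.NumberTheory.Automorphic
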